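import Literature.Probability.RandomPlanarGeometry.HexSAWIrreducibleWidthLaw
import Literature.Probability.RandomPlanarGeometry.HexSAWLowerBound
import Literature.Probability.Process.StrongRenewalTheorem
import Literature.Analysis.Asymptotics.PowerSumAbelian
import Mathlib.Analysis.SpecialFunctions.Trigonometric.Basic
import HarnessLib

/-!
# The strong renewal theorem on the critical hexagonal strip renewal: `B_T ∼ c₁ T^{δ−1}`, `U_T ∼ (c₁/δ) T^δ`,
# and the parameter-free Erickson limit `r_T (1 + U_T) → sin(πδ)/(πδ)` — conditional on a pure-power tail

Topic `Literature/Probability/RandomPlanarGeometry` (the hexagonal twin of `SAWBridgeStrongRenewal.lean`; continues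
`HexSAWIrreducibleWidthLaw.lean` — `HV.irrTail` (`r_T`), `HV.bridgeMass` (`U_T`), Kesten's identity
`HV.hasSum_stripIlim`, the renewal equation `HV.renewal_equation_range` — and uses the named fact
`Process/StrongRenewalTheorem.lean` and the Abelian step `Analysis/Asymptotics/PowerSumAbelian.lean`).

Sources: F. Caravenna, R. Doney, *Local large deviations and the strong renewal theorem*, EJP 24 (2019),
Theorem 1.4 (first bullet; arXiv:1612.07635 p0004:L137–146): for `α > 1/2` the SRT holds without further
assumptions — the tree's NAMED FACT `Renewal.CaravennaDoney2019_thm1_4_i` (discrete pure-power case);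
H. Duminil-Copin, S. Smirnov, Ann. of Math. 175 (2012), §3 (the strip renewal at `x_c`); K. B. Erickson,
Trans. AMS 185 (1973), Lemma 1 (the renewal sandwich `1 ≤ m(t)U(t)/t ≤ 2`); Bingham–Goldie–Teugels (1987),
§1.5.6 (Karamata). No source applies the SRT to the hexagonal self-avoiding-walk strips; everything below is
CONDITIONAL on exactly two hypotheses — the SRT named fact (published, unproved in the tree) and the pure-power
tail hypothesis `HexIrrTailRV δ C` (not established in print; the value predicted by Duminil-Copin–Smirnov's
`B_T ≍ T^{−1/4}` is `δ = 3/4`).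

## Contents (namespace `Literature.Probability.RandomPlanarGeometry.SAW.HV`)

* `HexIrrTailRV δ C` — the hypothesis `r_T · T^δ → C > 0` (a-idea-1's R54 (C) hypothesis, body verbatim);
* **`tendsto_stripBlim_rpow_of_irrTailRV`** (R54-C4) — SRT + `HexIrrTailRV δ C`, `1/2 < δ < 1` ⇒
  `B_n(x_c) · n^{1−δ} → sin(πδ)/(πC)`;
* **`tendsto_bridgeMass_mul_rpow_neg`** (R54-C5, unconditional Abelian step) — `B_n · n^{1−δ} → c₁`, `0 < δ < 1`
  ⇒ `U_T · T^{−δ} → c₁/δ`;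
* **`tendsto_irrTail_mul_one_add_bridgeMass`** (R54-C6, limit algebra) — `r_T T^δ → C` and
  `U_T T^{−δ} → sin(πδ)/(πC)/δ` ⇒ `r_T (1 + U_T) → sin(πδ)/(πδ)` (the constant `C` cancels);
* **`tendsto_irrTail_mul_one_add_bridgeMass_of_irrTailRV`** (R54 (C) composed) — under the two hypotheses,
  `r_T (1 + U_T) → sin(πδ)/(πδ)` (`= 2√2/(3π) = 0.30011…` at `δ = 3/4`; compare the unconditional Erickson
  sandwich `T+1 ≤ (1+U_T) Σ_{j≤T} r_j ≤ 2T+1` of `HexSAWIrreducibleWidthLog.lean`).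
(Lane «pcv-sawmu» route R54 (C); a-idea-1 typed `Sketch_G11.lean` §R54 (C), a-p3 proved.)

LABEL OF RECORD. CONDITIONAL LAW (hex transplant of the Erickson/DCS renewal structure): under the SRT and a
pure-power irreducible-width tail `r_T ∼ C·T^{−δ}`, `½ < δ < 1`, `r_T·(1 + U_T) → sin(πδ)/(πδ)`; the unconditional
content is C5 (`PowerSumAbelian.lean`) and C6; the tail law is the route's main input and is not established in
print (Duminil-Copin–Smirnov predict `B_T ≍ T^{−1/4}`, i.e. `δ = 3/4`) — this file is NOT a theorem about hexagonal
self-avoiding walks beyond its hypotheses.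

CONSISTENCY OF THE HYPOTHESES against the tree (why the implications are not vacuous): `HexIrrTailRV δ C` with
`½ < δ < 1` is compatible with everything the tree proves about `r_T` — the upper bound
`HV.irrTail_le_inv_log_numeric` (`r_T ≤ 1/(1 + log(T+1)/(2+√2))`, `HexSAWIrreducibleWidthLaw.lean`) decays slower
than any `C T^{−δ}`; the divergence `HV.tendsto_sum_irrTail_atTop` (`Σ_{j≤T} r_j → ∞`, i.e. infinite mean width,
`HexSAWIrreducibleWidthLog.lean`) only excludes `δ > 1`; and the Erickson sandwich `HV.hexEricksonSandwich`
(`T+1 ≤ (1+U_T) Σ_{j≤T} r_j ≤ 2T+1`) is consistent with the conclusions here, which give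
`(1+U_T) Σ_{j≤T} r_j ∼ sin(πδ)/(πδ(1−δ)) · T` with `sin(πδ)/(πδ(1−δ)) ∈ (1, 4/π] ⊂ [1,2]` on `½ < δ < 1`
(`= 1.2004` at `δ = 3/4`). The range `δ ≤ ½` is excluded BY HYPOTHESIS (the SRT named fact requires `α > ½`), not
by a theorem of the tree. The SRT itself is a published theorem (Caravenna–Doney 2019) carried as a named fact.
-/

noncomputable section

open Finset Filter Topology

namespace Literature.Probability.RandomPlanarGeometry.SAW

namespace HV

/-- **The pure-power tail hypothesis `HexIrrTailRV δ C`** (a predicate, used only as a HYPOTHESIS): the width tail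
`r_T = P(width > T)` of Kesten's irreducible-bridge measure on the critical hexagonal strips satisfies
`r_T · T^δ → C > 0`, i.e. hypothesis (1.7) of Caravenna–Doney with the pure-power scale `A(x) = x^δ/C`. No value of
`δ` is established in print (the predicted value is `δ = 3/4`). (a-idea-1's R54 (C) hypothesis, body verbatim; the
hexagonal analogue of the tree's `Zd.KestenTailRV`.)
[cite: CaravennaDoney2019, eq. (1.7); DuminilCopinSmirnov2012, §3] -/
def HexIrrTailRV (δ C : ℝ) : Prop :=
  0 < C ∧ Tendsto (fun T : ℕ => irrTail T * (T : ℝ) ^ δ) atTop (𝓝 C)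

/-! ### The renewal data in Feller's indexing (`u_0 = 1`, `u_n = B_n`; `f_0 = 0`, `f_t = I_t`) -/

/-- `u_n`: `u_0 = 1`, `u_n = B_n(x_c)` for `n ≥ 1` (plumbing). [folklore] -/
private def rU (n : ℕ) : ℝ := if n = 0 then 1 else stripBlim n

/-- `f_t`: `f_0 = 0`, `f_t = I_t(x_c)` for `t ≥ 1` (plumbing). [folklore] -/
private def rF (t : ℕ) : ℝ := if t = 0 then 0 else stripIlim t

/-- `u_0 = 1`. [folklore] -/
private theorem rU_zero : rU 0 = 1 := if_pos rfl

/-- `u_n = B_n` for `n ≠ 0`. [folklore] -/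
private theorem rU_of_ne {n : ℕ} (hn : n ≠ 0) : rU n = stripBlim n := if_neg hn

/-- `f_0 = 0`. [folklore] -/
private theorem rF_zero : rF 0 = 0 := if_pos rfl

/-- `f_t = I_t` for `t ≠ 0`. [folklore] -/
private theorem rF_of_ne {t : ℕ} (ht : t ≠ 0) : rF t = stripIlim t := if_neg ht

/-- `0 ≤ u_n`. [folklore] -/
private theorem rU_nonneg (n : ℕ) : 0 ≤ rU n := by
  rcases Nat.eq_zero_or_pos n with rfl | hn
  · rw [rU_zero]; norm_num
  · rw [rU_of_ne hn.ne']; exact stripBlim_nonneg hn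

/-- `u_n ≤ 1` (Duminil-Copin–Smirnov Lemma 2 in the limit). [cite: DuminilCopinSmirnov2012, Lemma 2 and §3] -/
private theorem rU_le_one (n : ℕ) : rU n ≤ 1 := by
  rcases Nat.eq_zero_or_pos n with rfl | hn
  · rw [rU_zero]
  · rw [rU_of_ne hn.ne']
    exact ciSup_le fun L => stripB_le_one_of_lemma2 DuminilCopinSmirnov2012_lemma2_holds hn L

/-- `0 ≤ f_t`. [folklore] -/
private theorem rF_nonneg (t : ℕ) : 0 ≤ rF t := by
  rcases Nat.eq_zero_or_pos t with rfl | ht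
  · rw [rF_zero]
  · rw [rF_of_ne ht.ne']; exact stripIlim_nonneg ht

/-- The renewal equation in Feller's indexing: `u_n = Σ_{k ≤ n} f_k u_{n-k}` (`n ≥ 1`).
[cite: Kesten1963SAW, §4; MadrasSlade1993, eq. (4.2.2)] -/
private theorem rU_renewal (n : ℕ) (hn : 1 ≤ n) : rU n = ∑ k ∈ range (n + 1), rF k * rU (n - k) := by
  obtain ⟨m, rfl⟩ : ∃ m, n = m + 1 := ⟨n - 1, by omega⟩
  rw [rU_of_ne (Nat.succ_ne_zero m), renewal_equation_range m, sum_range_succ', rF_zero, zero_mul, add_zero,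
    sum_range_succ]
  have hlast : rF (m + 1) * rU (m + 1 - (m + 1)) = stripIlim (m + 1) := by
    rw [Nat.sub_self, rU_zero, mul_one]; exact rF_of_ne (Nat.succ_ne_zero m)
  rw [hlast, add_left_inj]
  refine sum_congr rfl fun k hk => ?_
  rw [mem_range] at hk
  have hmk : m + 1 - (k + 1) = m - k := by omega
  rw [rF_of_ne (Nat.succ_ne_zero k), hmk, rU_of_ne (by omega)]

/-- `Σ_t f_t = 1` (Kesten's identity `hasSum_stripIlim`, reindexed). [cite: Kesten1963SAW, §4 (Thm. 5)] -/
private theorem hasSum_rF : HasSum rF 1 := by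
  have h : HasSum (fun n => rF (n + 1)) (1 - ∑ i ∈ range 1, rF i) := by
    have h1 : (fun n => rF (n + 1)) = fun n => stripIlim (n + 1) := funext fun n => rF_of_ne (Nat.succ_ne_zero n)
    rw [h1, sum_range_one, rF_zero, sub_zero]
    exact hasSum_stripIlim
  exact (hasSum_nat_add_iff' 1).1 h

/-- `f_1 = I_1 = B_1 > 0` (the renewal equation at width one and `B_1(x_c) > 0`). [cite: DuminilCopinSmirnov2012, §3] -/
private theorem rF_one_pos : 0 < rF 1 := by
  rw [rF_of_ne one_ne_zero]
  have h := renewal_equation_range 0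
  simp only [Finset.range_zero, Finset.sum_empty, zero_add] at h
  rw [← h]
  exact stripBlim_one_pos DuminilCopinSmirnov2012_lemma2_holds

/-- `Σ_{1 ≤ t ≤ n} g t = Σ_{k < n} g (k+1)` (reindexing). [folklore] -/
private theorem sum_Icc_eq_sum_range' (g : ℕ → ℝ) (n : ℕ) :
    ∑ t ∈ Icc 1 n, g t = ∑ k ∈ range n, g (k + 1) := by
  induction n with
  | zero => simp
  | succ n ih => rw [sum_range_succ, ← ih, Finset.sum_Icc_succ_top (by omega : 1 ≤ n + 1)]

/-- `r_n = 1 − Σ_{k ≤ n} f_k` (the tail sums of Madras–Slade (B.5)). [cite: MadrasSlade1993, Appendix B] -/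
private theorem irrTail_eq_rF' (n : ℕ) : irrTail n = 1 - ∑ k ∈ range (n + 1), rF k := by
  have e : (fun k : ℕ => rF (k + 1)) = fun k => stripIlim (k + 1) := funext fun k => rF_of_ne (Nat.succ_ne_zero k)
  have h : ∑ k ∈ range (n + 1), rF k = ∑ t ∈ Icc 1 n, stripIlim t := by
    rw [sum_range_succ', rF_zero, add_zero, sum_Icc_eq_sum_range', e]
  rw [h, irrTail]

/-! ### R54-C4: the strong renewal theorem on the hexagonal strip renewal -/

/-- **The strong renewal theorem applied to the critical hexagonal strip renewal** (R54-C4). Under the named fact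
`Renewal.CaravennaDoney2019_thm1_4_i` and the hypothesis `HexIrrTailRV δ C` with `1/2 < δ < 1`:
`B_n(x_c) · n^{1-δ} → sin(πδ)/(π C)`. The hexagonal twin of `Zd.tendsto_bridge_rpow_of_kestenTailRV`.
[cite: CaravennaDoney2019, Theorem 1.4 (first bullet); DuminilCopinSmirnov2012, §3] -/
theorem tendsto_stripBlim_rpow_of_irrTailRV
    (hSRT : _root_.Literature.Probability.Process.Renewal.CaravennaDoney2019_thm1_4_i) {δ C : ℝ}
    (hδ : 1 / 2 < δ) (hδ1 : δ < 1) (h : HexIrrTailRV δ C) :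
    Tendsto (fun n : ℕ => stripBlim n * (n : ℝ) ^ (1 - δ)) atTop (𝓝 (Real.sin (Real.pi * δ) / (Real.pi * C))) := by
  have htail : Tendsto (fun n : ℕ => (1 - ∑ k ∈ range (n + 1), rF k) * (n : ℝ) ^ δ) atTop (𝓝 C) := by
    refine h.2.congr fun n => ?_
    rw [irrTail_eq_rF']
  have key := hSRT rU rF δ C hδ hδ1 h.1 rU_zero rU_nonneg rU_le_one rF_nonneg rF_zero rU_renewal hasSum_rF
    rF_one_pos htail
  refine key.congr' ?_
  filter_upwards [eventually_ge_atTop 1] with n hn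
  rw [rU_of_ne (by omega)]

/-! ### R54-C5: the Abelian step for the bridge mass `U_T = Σ_{t ≤ T} B_t` -/

/-- **Abelian step for the bridge mass** (R54-C5, UNCONDITIONAL real analysis): if `B_n · n^{1−δ} → c₁` with
`0 < δ < 1` then `U_T · T^{−δ} → c₁/δ` (`U_T = Σ_{1 ≤ t ≤ T} B_t`; the discrete pure-power Karamata step of
`Literature.Analysis.Asymptotics.tendsto_sum_Icc_mul_rpow_neg`). [cite: BinghamGoldieTeugels1987, §1.5.6, Proposition 1.5.8] -/
theorem tendsto_bridgeMass_mul_rpow_neg {δ c₁ : ℝ} (hδ0 : 0 < δ) (hδ1 : δ < 1)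
    (hu : Tendsto (fun n : ℕ => stripBlim n * (n : ℝ) ^ (1 - δ)) atTop (𝓝 c₁)) :
    Tendsto (fun T : ℕ => bridgeMass T * (T : ℝ) ^ (-δ)) atTop (𝓝 (c₁ / δ)) := by
  unfold bridgeMass
  exact Literature.Analysis.Asymptotics.tendsto_sum_Icc_mul_rpow_neg hδ0 hδ1 hu

/-! ### R54-C6: the constant cancels -/

/-- **Limit algebra** (R54-C6): `r_T (1 + U_T) = (r_T T^δ) · ((1 + U_T) T^{−δ}) → C · (c₁/δ)`, and with the SRT value
`c₁ = sin(πδ)/(πC)` the constant `C` CANCELS: the limit is the universal `sin(πδ)/(πδ)` (Dynkin–Lamperti form).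
[cite: Erickson1973, Lemma 1; BinghamGoldieTeugels1987, §8.6] -/
theorem tendsto_irrTail_mul_one_add_bridgeMass {δ C : ℝ} (hδ0 : 0 < δ) (hC : 0 < C)
    (hr : Tendsto (fun T : ℕ => irrTail T * (T : ℝ) ^ δ) atTop (𝓝 C))
    (hU : Tendsto (fun T : ℕ => bridgeMass T * (T : ℝ) ^ (-δ)) atTop
      (𝓝 (Real.sin (Real.pi * δ) / (Real.pi * C) / δ))) :
    Tendsto (fun T : ℕ => irrTail T * (1 + bridgeMass T)) atTop
      (𝓝 (Real.sin (Real.pi * δ) / (Real.pi * δ))) := by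
  have hsmall : Tendsto (fun T : ℕ => (T : ℝ) ^ (-δ)) atTop (𝓝 0) :=
    (tendsto_rpow_neg_atTop hδ0).comp tendsto_natCast_atTop_atTop
  -- `(1 + U_T) T^{-δ} → 0 + L`
  have hU1 : Tendsto (fun T : ℕ => (1 + bridgeMass T) * (T : ℝ) ^ (-δ)) atTop
      (𝓝 (0 + Real.sin (Real.pi * δ) / (Real.pi * C) / δ)) := by
    refine (hsmall.add hU).congr fun T => ?_
    ring
  have hprod := hr.mul hU1
  have hlim : C * (0 + Real.sin (Real.pi * δ) / (Real.pi * C) / δ) = Real.sin (Real.pi * δ) / (Real.pi * δ) := by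
    rw [zero_add]
    field_simp
  rw [hlim] at hprod
  refine hprod.congr' ?_
  filter_upwards [eventually_ge_atTop 1] with T hT
  have hTpos : (0 : ℝ) < T := by exact_mod_cast hT
  have hpow : (T : ℝ) ^ δ * (T : ℝ) ^ (-δ) = 1 := by
    rw [Real.rpow_neg hTpos.le, mul_inv_cancel₀ (Real.rpow_pos_of_pos hTpos δ).ne']
  calc irrTail T * (T : ℝ) ^ δ * ((1 + bridgeMass T) * (T : ℝ) ^ (-δ))
      = irrTail T * (1 + bridgeMass T) * ((T : ℝ) ^ δ * (T : ℝ) ^ (-δ)) := by ring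
    _ = irrTail T * (1 + bridgeMass T) := by rw [hpow, mul_one]

/-! ### R54 (C) composed: the Erickson–SRT law of the critical hexagonal strip renewal (conditional) -/

/-- **The Erickson–SRT law of the critical hexagonal strip renewal (conditional; R54 (C) composed):** under the
strong renewal theorem (named fact) and the pure-power tail hypothesis `HexIrrTailRV δ C` with `1/2 < δ < 1`,
`r_T · (1 + U_T) → sin(πδ)/(πδ)` — a PARAMETER-FREE asymptote (at the predicted `δ = 3/4` the value is
`sin(3π/4)/(3π/4) = 2√2/(3π) = 0.30011…`). Unconditionally the tree has the Erickson sandwich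
`T + 1 ≤ (1 + U_T) Σ_{j ≤ T} r_j ≤ 2T + 1` (`HV.hexEricksonSandwich`). [cite: CaravennaDoney2019, Theorem 1.4 (first bullet); Erickson1973, Lemma 1] -/
theorem tendsto_irrTail_mul_one_add_bridgeMass_of_irrTailRV
    (hSRT : _root_.Literature.Probability.Process.Renewal.CaravennaDoney2019_thm1_4_i) {δ C : ℝ}
    (hδ : 1 / 2 < δ) (hδ1 : δ < 1) (h : HexIrrTailRV δ C) :
    Tendsto (fun T : ℕ => irrTail T * (1 + bridgeMass T)) atTop
      (𝓝 (Real.sin (Real.pi * δ) / (Real.pi * δ))) :=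
  tendsto_irrTail_mul_one_add_bridgeMass (by linarith) h.1 h.2
    (tendsto_bridgeMass_mul_rpow_neg (by linarith) hδ1 (tendsto_stripBlim_rpow_of_irrTailRV hSRT hδ hδ1 h))

end HV

end Literature.Probability.RandomPlanarGeometry.SAW

end
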